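import Summits.KontsevichZagierPeriods.KontsevichZagierPeriods.Theorems.HurwitzMicroSectorsNormalFormPrincipleM4KernelRefs
import Summits.KontsevichZagierPeriods.KontsevichZagierPeriods.Theorems.HurwitzMicroSectorsNormalFormPrincipleM4KernelReduceZeta
import Summits.KontsevichZagierPeriods.KontsevichZagierPeriods.Theorems.HurwitzMicroSectorsNormalFormPrincipleM4KernelReduceLog
import Summits.KontsevichZagierPeriods.KontsevichZagierPeriods.Theorems.MzvKernelInKZ.Negative.ScalingDivision
import Literature.NumberTheory.Transcendental.AperyIrrationality

/-!
# `NormalFormPrinciple` (stmt-KontsevichZagierPeriods-3869), line `SketchIdeator1` —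
# leaf `stub_boxRigidity`, layer `M4`: the DIMENSION-FOUR KERNEL

Pure proof file (registered sub-goal `m4Instances_mem_relations_of_eval_eq_zero`, lead seat c9;
`--supports` the crux). The dimension-four analogue of the capstone
`m3Instances_mem_relations_of_eval_eq_zero`: Kontsevich–Zagier's Conjecture 1 restricted to the
subgroup generated by nine families of RATIONAL four-dimensional boxes, conditionally on the
`ℚ`-linear independence of `ζ(4)` and `log 2 · ζ(3)` (a consequence of the standard transcendence
conjectures; the only transcendental input). Every reduction used is a chain of the five elementary
rule types landed by this line (cubical charts, dissections, dilations, shuffles, stuffles as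
partial fractions of product boxes, the product ideal) — `m4k4_reduce_zeta`, `m4k4_reduce_log`.
References: M. Kontsevich, D. Zagier, *Periods* (2001), §1.2 (Conjecture 1), §4.1.
No definitions are introduced.
-/

noncomputable section

open MeasureTheory Set
open Literature.NumberTheory.Transcendental Literature.NumberTheory.Transcendental.KZ
open Summit.KontsevichZagierPeriods.MzvKernelInKZ.Negative (mem_relations_of_nsmul_mem)

namespace Summit.KontsevichZagierPeriods.HurwitzMicroSectors.NormalFormPrinciple.PiBox.M3

/-- **The dimension-four kernel** (registered sub-goal `m4Instances_mem_relations_of_eval_eq_zero`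
of stmt-KontsevichZagierPeriods-3869, line `SketchIdeator1`, layer `M4`; lead seat c9). Assume
`ζ(4)` and `log 2 · ζ(3)` are `ℚ`-linearly independent. Then every `ℤ`-combination of
representations of the nine dimension-four rational box families
`[□⁴, 1/(1 ∓ Π)]`, `[□⁴, 1/((1 − xy)(1 − Π))]`, `[□⁴, 1/((1 − xyz)(1 − Π))]`,
`[□⁴, 1/((1 − xy)(1 − zw))]`, `[□⁴, 1/((1 + x)(1 ∓ yzw))]`, `[□⁴, 1/((1 ∓ xy)(1 + zw))]`
(`Π = xyzw`; values `ζ(4), (7/8)ζ(4), (7/4)ζ(4), (5/4)ζ(4), (5/2)ζ(4), log 2·ζ(3), (3/4)log 2·ζ(3),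
(5/4)ζ(4), (5/8)ζ(4)`) whose value vanishes is a relation of the Kontsevich–Zagier calculus: each
representative reduces, after multiplication by `8`, to an integer combination of the two
references `Z4 = [□⁴, 1/(1 − Π)]` and `C1 × Z3` (`m4k4_reduce_zeta`, `m4k4_reduce_log` — chains of
moves through the level-two relations of the campaign), the value of the reduction is
`α ζ(4) + β log 2 ζ(3) = 0`, independence kills `α, β`, and `8` is divided out by the scaling move.
[cite: KontsevichZagier2001, §1.2 Conjecture 1] -/
theorem m4Instances_mem_relations_of_eval_eq_zero
    (hind : LinearIndependent ℚ ![zetaValue 4, Real.log 2 * zetaValue 3])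
    {c : FormalRep}
    (hc : c ∈ AddSubgroup.closure
      ({y : FormalRep | ∃ N : IntegralRep 4, N.domain = {x | ∀ i, x i ∈ Set.Ioo (0:ℝ) 1} ∧
        EqOn N.integrand (fun x => 1 / (1 - x 0 * x 1 * x 2 * x 3)) N.domain ∧ y = of N} ∪
      {y : FormalRep | ∃ N : IntegralRep 4, N.domain = {x | ∀ i, x i ∈ Set.Ioo (0:ℝ) 1} ∧
        EqOn N.integrand (fun x => 1 / (1 + x 0 * x 1 * x 2 * x 3)) N.domain ∧ y = of N} ∪
      {y : FormalRep | ∃ N : IntegralRep 4, N.domain = {x | ∀ i, x i ∈ Set.Ioo (0:ℝ) 1} ∧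
        EqOn N.integrand (fun x => 1 / ((1 - x 0 * x 1) * (1 - x 0 * x 1 * x 2 * x 3))) N.domain ∧ y = of N} ∪
      {y : FormalRep | ∃ N : IntegralRep 4, N.domain = {x | ∀ i, x i ∈ Set.Ioo (0:ℝ) 1} ∧
        EqOn N.integrand (fun x => 1 / ((1 - x 0 * x 1 * x 2) * (1 - x 0 * x 1 * x 2 * x 3))) N.domain ∧ y = of N} ∪
      {y : FormalRep | ∃ N : IntegralRep 4, N.domain = {x | ∀ i, x i ∈ Set.Ioo (0:ℝ) 1} ∧
        EqOn N.integrand (fun x => 1 / ((1 - x 0 * x 1) * (1 - x 2 * x 3))) N.domain ∧ y = of N} ∪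
      {y : FormalRep | ∃ N : IntegralRep 4, N.domain = {x | ∀ i, x i ∈ Set.Ioo (0:ℝ) 1} ∧
        EqOn N.integrand (fun x => 1 / ((1 + x 0) * (1 - x 1 * x 2 * x 3))) N.domain ∧ y = of N} ∪
      {y : FormalRep | ∃ N : IntegralRep 4, N.domain = {x | ∀ i, x i ∈ Set.Ioo (0:ℝ) 1} ∧
        EqOn N.integrand (fun x => 1 / ((1 + x 0) * (1 + x 1 * x 2 * x 3))) N.domain ∧ y = of N} ∪
      {y : FormalRep | ∃ N : IntegralRep 4, N.domain = {x | ∀ i, x i ∈ Set.Ioo (0:ℝ) 1} ∧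
        EqOn N.integrand (fun x => 1 / ((1 - x 0 * x 1) * (1 + x 2 * x 3))) N.domain ∧ y = of N} ∪
      {y : FormalRep | ∃ N : IntegralRep 4, N.domain = {x | ∀ i, x i ∈ Set.Ioo (0:ℝ) 1} ∧
        EqOn N.integrand (fun x => 1 / ((1 + x 0 * x 1) * (1 + x 2 * x 3))) N.domain ∧ y = of N}))
    (hv : eval c = 0) : c ∈ relations := by
  obtain ⟨Z4, C1, Z3, hZ4d, hZ4i, hZ4v, hC1d, hC1i, hZ3d, hZ3i, hLv⟩ := m4r4_exists_refs
  obtain ⟨r1, r2, r3, r4, r5⟩ := m4k4_reduce_zeta Z4 C1 Z3 hZ4d hZ4i hC1d hC1i hZ3d hZ3i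
  obtain ⟨r6, r7, r8, r9⟩ := m4k4_reduce_log Z4 C1 Z3 hZ4d hZ4i hC1d hC1i hZ3d hZ3i
  -- every element of the subgroup reduces, after multiplication by `8`, to `α Z4 + β (C1 × Z3)`
  have hred : ∀ c ∈ AddSubgroup.closure
      ({y : FormalRep | ∃ N : IntegralRep 4, N.domain = {x | ∀ i, x i ∈ Set.Ioo (0:ℝ) 1} ∧
        EqOn N.integrand (fun x => 1 / (1 - x 0 * x 1 * x 2 * x 3)) N.domain ∧ y = of N} ∪
      {y : FormalRep | ∃ N : IntegralRep 4, N.domain = {x | ∀ i, x i ∈ Set.Ioo (0:ℝ) 1} ∧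
        EqOn N.integrand (fun x => 1 / (1 + x 0 * x 1 * x 2 * x 3)) N.domain ∧ y = of N} ∪
      {y : FormalRep | ∃ N : IntegralRep 4, N.domain = {x | ∀ i, x i ∈ Set.Ioo (0:ℝ) 1} ∧
        EqOn N.integrand (fun x => 1 / ((1 - x 0 * x 1) * (1 - x 0 * x 1 * x 2 * x 3))) N.domain ∧ y = of N} ∪
      {y : FormalRep | ∃ N : IntegralRep 4, N.domain = {x | ∀ i, x i ∈ Set.Ioo (0:ℝ) 1} ∧
        EqOn N.integrand (fun x => 1 / ((1 - x 0 * x 1 * x 2) * (1 - x 0 * x 1 * x 2 * x 3))) N.domain ∧ y = of N} ∪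
      {y : FormalRep | ∃ N : IntegralRep 4, N.domain = {x | ∀ i, x i ∈ Set.Ioo (0:ℝ) 1} ∧
        EqOn N.integrand (fun x => 1 / ((1 - x 0 * x 1) * (1 - x 2 * x 3))) N.domain ∧ y = of N} ∪
      {y : FormalRep | ∃ N : IntegralRep 4, N.domain = {x | ∀ i, x i ∈ Set.Ioo (0:ℝ) 1} ∧
        EqOn N.integrand (fun x => 1 / ((1 + x 0) * (1 - x 1 * x 2 * x 3))) N.domain ∧ y = of N} ∪
      {y : FormalRep | ∃ N : IntegralRep 4, N.domain = {x | ∀ i, x i ∈ Set.Ioo (0:ℝ) 1} ∧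
        EqOn N.integrand (fun x => 1 / ((1 + x 0) * (1 + x 1 * x 2 * x 3))) N.domain ∧ y = of N} ∪
      {y : FormalRep | ∃ N : IntegralRep 4, N.domain = {x | ∀ i, x i ∈ Set.Ioo (0:ℝ) 1} ∧
        EqOn N.integrand (fun x => 1 / ((1 - x 0 * x 1) * (1 + x 2 * x 3))) N.domain ∧ y = of N} ∪
      {y : FormalRep | ∃ N : IntegralRep 4, N.domain = {x | ∀ i, x i ∈ Set.Ioo (0:ℝ) 1} ∧
        EqOn N.integrand (fun x => 1 / ((1 + x 0 * x 1) * (1 + x 2 * x 3))) N.domain ∧ y = of N}),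
      ∃ α β : ℤ, (8:ℕ) • c - (α • of Z4 + β • of (C1.prod Z3)) ∈ relations := by
    intro c hc
    induction hc using AddSubgroup.closure_induction with
    | mem y hy =>
      simp only [mem_union, mem_setOf_eq] at hy
      rcases hy with ((((((((⟨N, hNd, hNi, rfl⟩ | ⟨N, hNd, hNi, rfl⟩) | ⟨N, hNd, hNi, rfl⟩) | ⟨N, hNd, hNi, rfl⟩) | ⟨N, hNd, hNi, rfl⟩) | ⟨N, hNd, hNi, rfl⟩) | ⟨N, hNd, hNi, rfl⟩) | ⟨N, hNd, hNi, rfl⟩) | ⟨N, hNd, hNi, rfl⟩)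
      · exact ⟨8, 0, r1 N hNd hNi⟩
      · exact ⟨7, 0, r2 N hNd hNi⟩
      · exact ⟨14, 0, r3 N hNd hNi⟩
      · exact ⟨10, 0, r4 N hNd hNi⟩
      · exact ⟨20, 0, r5 N hNd hNi⟩
      · exact ⟨0, 8, r6 N hNd hNi⟩
      · exact ⟨0, 6, r7 N hNd hNi⟩
      · exact ⟨10, 0, r8 N hNd hNi⟩
      · exact ⟨5, 0, r9 N hNd hNi⟩
    | zero =>
      refine ⟨0, 0, ?_⟩
      simp only [smul_zero, zero_smul, add_zero, sub_zero]
      exact relations.zero_mem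
    | add y z _ _ ihy ihz =>
      obtain ⟨α₁, β₁, h₁⟩ := ihy
      obtain ⟨α₂, β₂, h₂⟩ := ihz
      refine ⟨α₁ + α₂, β₁ + β₂, ?_⟩
      have e : (8:ℕ) • (y + z) - ((α₁ + α₂) • of Z4 + (β₁ + β₂) • of (C1.prod Z3)) =
          ((8:ℕ) • y - (α₁ • of Z4 + β₁ • of (C1.prod Z3))) +
            ((8:ℕ) • z - (α₂ • of Z4 + β₂ • of (C1.prod Z3))) := by
        simp only [smul_add, add_smul]; abel
      rw [e]
      exact relations.add_mem h₁ h₂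
    | neg y _ ih =>
      obtain ⟨α, β, h⟩ := ih
      refine ⟨-α, -β, ?_⟩
      have e : (8:ℕ) • (-y) - ((-α) • of Z4 + (-β) • of (C1.prod Z3)) =
          -((8:ℕ) • y - (α • of Z4 + β • of (C1.prod Z3))) := by
        simp only [smul_neg, neg_smul]; abel
      rw [e]
      exact relations.neg_mem h
  obtain ⟨α, β, h⟩ := hred c hc
  -- evaluate: `0 = α ζ(4) + β log 2 ζ(3)`
  have hev := relations_le_ker_eval_holds h
  rw [AddMonoidHom.mem_ker, map_sub, map_nsmul, map_add, map_zsmul, map_zsmul, eval_of, eval_of,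
    hv, hZ4v, hLv, smul_zero, zero_sub, neg_eq_zero] at hev
  have hαβ : α = 0 ∧ β = 0 := by
    rw [Fintype.linearIndependent_iff] at hind
    have key := hind ![(α : ℚ), (β : ℚ)] (by
      rw [Fin.sum_univ_two]
      simp only [Matrix.cons_val_zero, Matrix.cons_val_one, Rat.smul_def]
      push_cast
      rw [zsmul_eq_mul, zsmul_eq_mul] at hev
      linarith)
    have h0 := key 0
    have h1 := key 1
    simp only [Matrix.cons_val_zero, Matrix.cons_val_one] at h0 h1
    exact ⟨by exact_mod_cast h0, by exact_mod_cast h1⟩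
  obtain ⟨rfl, rfl⟩ := hαβ
  simp only [zero_smul, add_zero, sub_zero] at h
  exact mem_relations_of_nsmul_mem (by norm_num) h

/-- **Conjecture 1 (the leaf `stub_boxRigidity`) on the nine dimension-four box families,
conditionally on `LinearIndependent ℚ ![ζ(4), log 2·ζ(3)]`**: two representations taken from these
families with equal values are KZ-equivalent. [cite: KontsevichZagier2001, §1.2 Conjecture 1] -/
theorem m4Instances_equivalent_of_value_eq
    (hind : LinearIndependent ℚ ![zetaValue 4, Real.log 2 * zetaValue 3])
    {N N' : IntegralRep 4}
    (hN : of N ∈ ({y : FormalRep | ∃ N : IntegralRep 4, N.domain = {x | ∀ i, x i ∈ Set.Ioo (0:ℝ) 1} ∧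
        EqOn N.integrand (fun x => 1 / (1 - x 0 * x 1 * x 2 * x 3)) N.domain ∧ y = of N} ∪
      {y : FormalRep | ∃ N : IntegralRep 4, N.domain = {x | ∀ i, x i ∈ Set.Ioo (0:ℝ) 1} ∧
        EqOn N.integrand (fun x => 1 / (1 + x 0 * x 1 * x 2 * x 3)) N.domain ∧ y = of N} ∪
      {y : FormalRep | ∃ N : IntegralRep 4, N.domain = {x | ∀ i, x i ∈ Set.Ioo (0:ℝ) 1} ∧
        EqOn N.integrand (fun x => 1 / ((1 - x 0 * x 1) * (1 - x 0 * x 1 * x 2 * x 3))) N.domain ∧ y = of N} ∪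
      {y : FormalRep | ∃ N : IntegralRep 4, N.domain = {x | ∀ i, x i ∈ Set.Ioo (0:ℝ) 1} ∧
        EqOn N.integrand (fun x => 1 / ((1 - x 0 * x 1 * x 2) * (1 - x 0 * x 1 * x 2 * x 3))) N.domain ∧ y = of N} ∪
      {y : FormalRep | ∃ N : IntegralRep 4, N.domain = {x | ∀ i, x i ∈ Set.Ioo (0:ℝ) 1} ∧
        EqOn N.integrand (fun x => 1 / ((1 - x 0 * x 1) * (1 - x 2 * x 3))) N.domain ∧ y = of N} ∪
      {y : FormalRep | ∃ N : IntegralRep 4, N.domain = {x | ∀ i, x i ∈ Set.Ioo (0:ℝ) 1} ∧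
        EqOn N.integrand (fun x => 1 / ((1 + x 0) * (1 - x 1 * x 2 * x 3))) N.domain ∧ y = of N} ∪
      {y : FormalRep | ∃ N : IntegralRep 4, N.domain = {x | ∀ i, x i ∈ Set.Ioo (0:ℝ) 1} ∧
        EqOn N.integrand (fun x => 1 / ((1 + x 0) * (1 + x 1 * x 2 * x 3))) N.domain ∧ y = of N} ∪
      {y : FormalRep | ∃ N : IntegralRep 4, N.domain = {x | ∀ i, x i ∈ Set.Ioo (0:ℝ) 1} ∧
        EqOn N.integrand (fun x => 1 / ((1 - x 0 * x 1) * (1 + x 2 * x 3))) N.domain ∧ y = of N} ∪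
      {y : FormalRep | ∃ N : IntegralRep 4, N.domain = {x | ∀ i, x i ∈ Set.Ioo (0:ℝ) 1} ∧
        EqOn N.integrand (fun x => 1 / ((1 + x 0 * x 1) * (1 + x 2 * x 3))) N.domain ∧ y = of N}))
    (hN' : of N' ∈ ({y : FormalRep | ∃ N : IntegralRep 4, N.domain = {x | ∀ i, x i ∈ Set.Ioo (0:ℝ) 1} ∧
        EqOn N.integrand (fun x => 1 / (1 - x 0 * x 1 * x 2 * x 3)) N.domain ∧ y = of N} ∪
      {y : FormalRep | ∃ N : IntegralRep 4, N.domain = {x | ∀ i, x i ∈ Set.Ioo (0:ℝ) 1} ∧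
        EqOn N.integrand (fun x => 1 / (1 + x 0 * x 1 * x 2 * x 3)) N.domain ∧ y = of N} ∪
      {y : FormalRep | ∃ N : IntegralRep 4, N.domain = {x | ∀ i, x i ∈ Set.Ioo (0:ℝ) 1} ∧
        EqOn N.integrand (fun x => 1 / ((1 - x 0 * x 1) * (1 - x 0 * x 1 * x 2 * x 3))) N.domain ∧ y = of N} ∪
      {y : FormalRep | ∃ N : IntegralRep 4, N.domain = {x | ∀ i, x i ∈ Set.Ioo (0:ℝ) 1} ∧
        EqOn N.integrand (fun x => 1 / ((1 - x 0 * x 1 * x 2) * (1 - x 0 * x 1 * x 2 * x 3))) N.domain ∧ y = of N} ∪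
      {y : FormalRep | ∃ N : IntegralRep 4, N.domain = {x | ∀ i, x i ∈ Set.Ioo (0:ℝ) 1} ∧
        EqOn N.integrand (fun x => 1 / ((1 - x 0 * x 1) * (1 - x 2 * x 3))) N.domain ∧ y = of N} ∪
      {y : FormalRep | ∃ N : IntegralRep 4, N.domain = {x | ∀ i, x i ∈ Set.Ioo (0:ℝ) 1} ∧
        EqOn N.integrand (fun x => 1 / ((1 + x 0) * (1 - x 1 * x 2 * x 3))) N.domain ∧ y = of N} ∪
      {y : FormalRep | ∃ N : IntegralRep 4, N.domain = {x | ∀ i, x i ∈ Set.Ioo (0:ℝ) 1} ∧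
        EqOn N.integrand (fun x => 1 / ((1 + x 0) * (1 + x 1 * x 2 * x 3))) N.domain ∧ y = of N} ∪
      {y : FormalRep | ∃ N : IntegralRep 4, N.domain = {x | ∀ i, x i ∈ Set.Ioo (0:ℝ) 1} ∧
        EqOn N.integrand (fun x => 1 / ((1 - x 0 * x 1) * (1 + x 2 * x 3))) N.domain ∧ y = of N} ∪
      {y : FormalRep | ∃ N : IntegralRep 4, N.domain = {x | ∀ i, x i ∈ Set.Ioo (0:ℝ) 1} ∧
        EqOn N.integrand (fun x => 1 / ((1 + x 0 * x 1) * (1 + x 2 * x 3))) N.domain ∧ y = of N}))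
    (hval : N.value = N'.value) : Equivalent N N' := by
  refine m4Instances_mem_relations_of_eval_eq_zero hind
    (AddSubgroup.sub_mem _ (AddSubgroup.subset_closure hN) (AddSubgroup.subset_closure hN')) ?_
  rw [map_sub, eval_of, eval_of, hval, sub_self]

/-- `ζ(4) > 0` (the series `∑ 1/n⁴` over `n ≥ 1`, junk term `0` at `n = 0`). [folklore] -/
theorem m4k_zetaValue_four_pos : 0 < zetaValue 4 := by
  unfold zetaValue
  exact (Real.summable_one_div_nat_pow.2 (by norm_num)).tsum_pos (fun n => by positivity) 1
    (by norm_num)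

/-- **Conjecture 1 UNCONDITIONALLY on the seven `ζ(4)`-valued dimension-four box families** (lead
seat c9, line `SketchIdeator1`, layer `M4`). Every `ℤ`-combination of representations of
`[□⁴, 1/(1∓Π)]`, `[□⁴, 1/((1−xy)(1−Π))]`, `[□⁴, 1/((1−xyz)(1−Π))]`, `[□⁴, 1/((1−xy)(1−zw))]`,
`[□⁴, 1/((1−xy)(1+zw))]`, `[□⁴, 1/((1+xy)(1+zw))]` whose value vanishes is a relation of the
Kontsevich–Zagier calculus — no transcendence hypothesis: each reduces to an integer multiple of
the `ζ(4)` box, and `ζ(4) > 0`. [cite: KontsevichZagier2001, §1.2 Conjecture 1] -/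
theorem m4ZetaFourFamilies_mem_relations_of_eval_eq_zero
    {c : FormalRep}
    (hc : c ∈ AddSubgroup.closure
      ({y : FormalRep | ∃ N : IntegralRep 4, N.domain = {x | ∀ i, x i ∈ Set.Ioo (0:ℝ) 1} ∧
        EqOn N.integrand (fun x => 1 / (1 - x 0 * x 1 * x 2 * x 3)) N.domain ∧ y = of N} ∪
      {y : FormalRep | ∃ N : IntegralRep 4, N.domain = {x | ∀ i, x i ∈ Set.Ioo (0:ℝ) 1} ∧
        EqOn N.integrand (fun x => 1 / (1 + x 0 * x 1 * x 2 * x 3)) N.domain ∧ y = of N} ∪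
      {y : FormalRep | ∃ N : IntegralRep 4, N.domain = {x | ∀ i, x i ∈ Set.Ioo (0:ℝ) 1} ∧
        EqOn N.integrand (fun x => 1 / ((1 - x 0 * x 1) * (1 - x 0 * x 1 * x 2 * x 3))) N.domain ∧ y = of N} ∪
      {y : FormalRep | ∃ N : IntegralRep 4, N.domain = {x | ∀ i, x i ∈ Set.Ioo (0:ℝ) 1} ∧
        EqOn N.integrand (fun x => 1 / ((1 - x 0 * x 1 * x 2) * (1 - x 0 * x 1 * x 2 * x 3))) N.domain ∧ y = of N} ∪
      {y : FormalRep | ∃ N : IntegralRep 4, N.domain = {x | ∀ i, x i ∈ Set.Ioo (0:ℝ) 1} ∧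
        EqOn N.integrand (fun x => 1 / ((1 - x 0 * x 1) * (1 - x 2 * x 3))) N.domain ∧ y = of N} ∪
      {y : FormalRep | ∃ N : IntegralRep 4, N.domain = {x | ∀ i, x i ∈ Set.Ioo (0:ℝ) 1} ∧
        EqOn N.integrand (fun x => 1 / ((1 - x 0 * x 1) * (1 + x 2 * x 3))) N.domain ∧ y = of N} ∪
      {y : FormalRep | ∃ N : IntegralRep 4, N.domain = {x | ∀ i, x i ∈ Set.Ioo (0:ℝ) 1} ∧
        EqOn N.integrand (fun x => 1 / ((1 + x 0 * x 1) * (1 + x 2 * x 3))) N.domain ∧ y = of N}))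
    (hv : eval c = 0) : c ∈ relations := by
  obtain ⟨Z4, C1, Z3, hZ4d, hZ4i, hZ4v, hC1d, hC1i, hZ3d, hZ3i, hLv⟩ := m4r4_exists_refs
  obtain ⟨r1, r2, r3, r4, r5⟩ := m4k4_reduce_zeta Z4 C1 Z3 hZ4d hZ4i hC1d hC1i hZ3d hZ3i
  obtain ⟨r6, r7, r8, r9⟩ := m4k4_reduce_log Z4 C1 Z3 hZ4d hZ4i hC1d hC1i hZ3d hZ3i
  have hred : ∀ c ∈ AddSubgroup.closure
      ({y : FormalRep | ∃ N : IntegralRep 4, N.domain = {x | ∀ i, x i ∈ Set.Ioo (0:ℝ) 1} ∧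
        EqOn N.integrand (fun x => 1 / (1 - x 0 * x 1 * x 2 * x 3)) N.domain ∧ y = of N} ∪
      {y : FormalRep | ∃ N : IntegralRep 4, N.domain = {x | ∀ i, x i ∈ Set.Ioo (0:ℝ) 1} ∧
        EqOn N.integrand (fun x => 1 / (1 + x 0 * x 1 * x 2 * x 3)) N.domain ∧ y = of N} ∪
      {y : FormalRep | ∃ N : IntegralRep 4, N.domain = {x | ∀ i, x i ∈ Set.Ioo (0:ℝ) 1} ∧
        EqOn N.integrand (fun x => 1 / ((1 - x 0 * x 1) * (1 - x 0 * x 1 * x 2 * x 3))) N.domain ∧ y = of N} ∪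
      {y : FormalRep | ∃ N : IntegralRep 4, N.domain = {x | ∀ i, x i ∈ Set.Ioo (0:ℝ) 1} ∧
        EqOn N.integrand (fun x => 1 / ((1 - x 0 * x 1 * x 2) * (1 - x 0 * x 1 * x 2 * x 3))) N.domain ∧ y = of N} ∪
      {y : FormalRep | ∃ N : IntegralRep 4, N.domain = {x | ∀ i, x i ∈ Set.Ioo (0:ℝ) 1} ∧
        EqOn N.integrand (fun x => 1 / ((1 - x 0 * x 1) * (1 - x 2 * x 3))) N.domain ∧ y = of N} ∪
      {y : FormalRep | ∃ N : IntegralRep 4, N.domain = {x | ∀ i, x i ∈ Set.Ioo (0:ℝ) 1} ∧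
        EqOn N.integrand (fun x => 1 / ((1 - x 0 * x 1) * (1 + x 2 * x 3))) N.domain ∧ y = of N} ∪
      {y : FormalRep | ∃ N : IntegralRep 4, N.domain = {x | ∀ i, x i ∈ Set.Ioo (0:ℝ) 1} ∧
        EqOn N.integrand (fun x => 1 / ((1 + x 0 * x 1) * (1 + x 2 * x 3))) N.domain ∧ y = of N}),
      ∃ α : ℤ, (8:ℕ) • c - α • of Z4 ∈ relations := by
    intro c hc
    induction hc using AddSubgroup.closure_induction with
    | mem y hy =>
      simp only [mem_union, mem_setOf_eq] at hy
      rcases hy with ((((((⟨N, hNd, hNi, rfl⟩ | ⟨N, hNd, hNi, rfl⟩) | ⟨N, hNd, hNi, rfl⟩) | ⟨N, hNd, hNi, rfl⟩) | ⟨N, hNd, hNi, rfl⟩) | ⟨N, hNd, hNi, rfl⟩) | ⟨N, hNd, hNi, rfl⟩)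
      · exact ⟨8, by simpa only [zero_smul, add_zero] using r1 N hNd hNi⟩
      · exact ⟨7, by simpa only [zero_smul, add_zero] using r2 N hNd hNi⟩
      · exact ⟨14, by simpa only [zero_smul, add_zero] using r3 N hNd hNi⟩
      · exact ⟨10, by simpa only [zero_smul, add_zero] using r4 N hNd hNi⟩
      · exact ⟨20, by simpa only [zero_smul, add_zero] using r5 N hNd hNi⟩
      · exact ⟨10, by simpa only [zero_smul, add_zero] using r8 N hNd hNi⟩
      · exact ⟨5, by simpa only [zero_smul, add_zero] using r9 N hNd hNi⟩
    | zero =>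
      refine ⟨0, ?_⟩
      simp only [smul_zero, zero_smul, sub_zero]
      exact relations.zero_mem
    | add y z _ _ ihy ihz =>
      obtain ⟨α₁, h₁⟩ := ihy
      obtain ⟨α₂, h₂⟩ := ihz
      refine ⟨α₁ + α₂, ?_⟩
      have e : (8:ℕ) • (y + z) - (α₁ + α₂) • of Z4 =
          ((8:ℕ) • y - α₁ • of Z4) + ((8:ℕ) • z - α₂ • of Z4) := by
        simp only [smul_add, add_smul]; abel
      rw [e]
      exact relations.add_mem h₁ h₂
    | neg y _ ih =>
      obtain ⟨α, h⟩ := ih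
      refine ⟨-α, ?_⟩
      have e : (8:ℕ) • (-y) - (-α) • of Z4 = -((8:ℕ) • y - α • of Z4) := by
        simp only [smul_neg, neg_smul]; abel
      rw [e]
      exact relations.neg_mem h
  obtain ⟨α, h⟩ := hred c hc
  have hev := relations_le_ker_eval_holds h
  rw [AddMonoidHom.mem_ker, map_sub, map_nsmul, map_zsmul, eval_of, hv, hZ4v, smul_zero,
    zero_sub, neg_eq_zero, zsmul_eq_mul, mul_eq_zero] at hev
  have hα : α = 0 := by
    rcases hev with h0 | h0
    · exact_mod_cast h0
    · exact absurd h0 (ne_of_gt m4k_zetaValue_four_pos)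
  subst hα
  simp only [zero_smul, sub_zero] at h
  exact mem_relations_of_nsmul_mem (by norm_num) h

/-- **Conjecture 1 UNCONDITIONALLY on the two `log 2·ζ(3)`-valued dimension-four box families**
(lead seat c9, line `SketchIdeator1`, layer `M4`): `[□⁴, 1/((1+x)(1−yzw))]`, `[□⁴, 1/((1+x)(1+yzw))]`
— reductions to the product `C1 × Z3` of value `log 2 · ζ(3) > 0`.
[cite: KontsevichZagier2001, §1.2 Conjecture 1] -/
theorem m4LogZetaThreeFamilies_mem_relations_of_eval_eq_zero
    {c : FormalRep}
    (hc : c ∈ AddSubgroup.closure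
      ({y : FormalRep | ∃ N : IntegralRep 4, N.domain = {x | ∀ i, x i ∈ Set.Ioo (0:ℝ) 1} ∧
        EqOn N.integrand (fun x => 1 / ((1 + x 0) * (1 - x 1 * x 2 * x 3))) N.domain ∧ y = of N} ∪
      {y : FormalRep | ∃ N : IntegralRep 4, N.domain = {x | ∀ i, x i ∈ Set.Ioo (0:ℝ) 1} ∧
        EqOn N.integrand (fun x => 1 / ((1 + x 0) * (1 + x 1 * x 2 * x 3))) N.domain ∧ y = of N}))
    (hv : eval c = 0) : c ∈ relations := by
  obtain ⟨Z4, C1, Z3, hZ4d, hZ4i, hZ4v, hC1d, hC1i, hZ3d, hZ3i, hLv⟩ := m4r4_exists_refs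
  obtain ⟨r1, r2, r3, r4, r5⟩ := m4k4_reduce_zeta Z4 C1 Z3 hZ4d hZ4i hC1d hC1i hZ3d hZ3i
  obtain ⟨r6, r7, r8, r9⟩ := m4k4_reduce_log Z4 C1 Z3 hZ4d hZ4i hC1d hC1i hZ3d hZ3i
  have hred : ∀ c ∈ AddSubgroup.closure
      ({y : FormalRep | ∃ N : IntegralRep 4, N.domain = {x | ∀ i, x i ∈ Set.Ioo (0:ℝ) 1} ∧
        EqOn N.integrand (fun x => 1 / ((1 + x 0) * (1 - x 1 * x 2 * x 3))) N.domain ∧ y = of N} ∪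
      {y : FormalRep | ∃ N : IntegralRep 4, N.domain = {x | ∀ i, x i ∈ Set.Ioo (0:ℝ) 1} ∧
        EqOn N.integrand (fun x => 1 / ((1 + x 0) * (1 + x 1 * x 2 * x 3))) N.domain ∧ y = of N}),
      ∃ α : ℤ, (8:ℕ) • c - α • of (C1.prod Z3) ∈ relations := by
    intro c hc
    induction hc using AddSubgroup.closure_induction with
    | mem y hy =>
      simp only [mem_union, mem_setOf_eq] at hy
      rcases hy with (⟨N, hNd, hNi, rfl⟩ | ⟨N, hNd, hNi, rfl⟩)
      · exact ⟨8, by simpa only [zero_smul, zero_add] using r6 N hNd hNi⟩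
      · exact ⟨6, by simpa only [zero_smul, zero_add] using r7 N hNd hNi⟩
    | zero =>
      refine ⟨0, ?_⟩
      simp only [smul_zero, zero_smul, sub_zero]
      exact relations.zero_mem
    | add y z _ _ ihy ihz =>
      obtain ⟨α₁, h₁⟩ := ihy
      obtain ⟨α₂, h₂⟩ := ihz
      refine ⟨α₁ + α₂, ?_⟩
      have e : (8:ℕ) • (y + z) - (α₁ + α₂) • of (C1.prod Z3) =
          ((8:ℕ) • y - α₁ • of (C1.prod Z3)) + ((8:ℕ) • z - α₂ • of (C1.prod Z3)) := by
        simp only [smul_add, add_smul]; abel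
      rw [e]
      exact relations.add_mem h₁ h₂
    | neg y _ ih =>
      obtain ⟨α, h⟩ := ih
      refine ⟨-α, ?_⟩
      have e : (8:ℕ) • (-y) - (-α) • of (C1.prod Z3) = -((8:ℕ) • y - α • of (C1.prod Z3)) := by
        simp only [smul_neg, neg_smul]; abel
      rw [e]
      exact relations.neg_mem h
  obtain ⟨α, h⟩ := hred c hc
  have hev := relations_le_ker_eval_holds h
  rw [AddMonoidHom.mem_ker, map_sub, map_nsmul, map_zsmul, eval_of, hv, hLv, smul_zero,
    zero_sub, neg_eq_zero, zsmul_eq_mul, mul_eq_zero] at hev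
  have hα : α = 0 := by
    rcases hev with h0 | h0
    · exact_mod_cast h0
    · exact absurd h0 ((mul_pos (Real.log_pos one_lt_two) Literature.NumberTheory.Transcendental.Apery.zeta_three_pos).ne')
  subst hα
  simp only [zero_smul, sub_zero] at h
  exact mem_relations_of_nsmul_mem (by norm_num) h

end Summit.KontsevichZagierPeriods.HurwitzMicroSectors.NormalFormPrinciple.PiBox.M3
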